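import Literature.NumberTheory.Automorphic.RegularOrbitChartNonarch   -- ★ chart-B (p839399) over ★ chart-A (p839282)
import Mathlib.Analysis.Normed.Operator.Banach
import HarnessLib

/-!
# The regular orbit chart, PRODUCT FORM: near a regular semisimple `A`, conjugation is a homeomorphism
# `(transversal slice) × (commutant) ⊃ nbhd of (0, 0) ≃ nbhd of A ⊂ M_n(F)` (inverse function theorem)

Topic `NumberTheory/Automorphic`; namespace `Literature.NumberTheory.Automorphic`. KERNEL mathematics only:
theorems, no definition, no named fact, no instance, no notation, no `sorry`.  Cell `pub/hodgecm-mathlib`, road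
«D-N6s», LEAD F0P3a-plan (g8) WORD T7-82 (4), brick «N6ns-chart-2» (sequel of ★ `RegularAdRangeSupCommutant` = chart-A
and ★ `RegularOrbitChartNonarch` = chart-B).  For `A ∈ M_n(F)` with separable characteristic polynomial (`F` a complete
nontrivially normed PERFECT field, e.g. any completion `L_w` of a number field), write `ad A := L_A − R_A`,
`𝔪 := range (ad A) = [A, M_n(F)]` (the transversal slice) and `𝔠 := ker (ad A) = C(A)` (the commutant, `= F[A]`, a
maximal commutative subalgebra — the tangent space of the centraliser torus); ★ chart-A: `M_n(F) = 𝔪 ⊕ 𝔠`.  The map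
`Φ(X, Y) := (1 + X)(A + Y)(1 + X)⁻¹` on `𝔪 × 𝔠` has strict derivative `(X, Y) ↦ XA − AX + Y = −ad A (X) + Y` at
`(0, 0)`, a linear ISOMORPHISM `𝔪 × 𝔠 ≃ M_n(F)` (`ad A` is injective on `𝔪`, ★ chart-A), so Mathlib's inverse function
theorem over `𝕜 = F` (`HasStrictFDerivAt.toOpenPartialHomeomorph`) makes `Φ` a homeomorphism between open
neighbourhoods of `(0, 0)` and of `A`:

* §1 (private) `hasStrictFDerivAt_conjOrbitMap_slice` — the strict derivative on `𝔪 × 𝔠` (chart-B's computation on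
  the slice); `ker_eq_bot_…` ∕ `range_eq_top_…` of that derivative.
* §2 **`exists_openPartialHomeomorph_conjOrbit`** — `∃ e : OpenPartialHomeomorph (𝔪 × 𝔠) (M_n F)`, `(0, 0) ∈ e.source`,
  `A ∈ e.target`, `e = Φ` pointwise: THE PRODUCT FORM of the regular orbit chart (Harish-Chandra's submersion principle
  in its «local product structure» reading: near `A`, a matrix is CONTINUOUSLY `W = (1 + X(W)) (A + Y(W)) (1 + X(W))⁻¹`
  with `Y(W)` in the torus algebra `C(A)` and `X(W)` in the slice) — what «transfer by regular charts» ((s3) of the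
  D-N6-ns census) integrates against.
NOT here: the restriction to a closed subgroup such as `U(J)(F_v) ⊂ GL_N(E_w)` (σ-fixed points of the chart) — a
separate brick.

## References

* [HarishChandra1970] Harish-Chandra (notes by G. van Dijk), *Harmonic Analysis on Reductive `p`-adic Groups*,
  LNM 162 (1970), Part I §3 (the map `G × T′ → G`, `(x, t) ↦ x t x⁻¹`, is everywhere submersive; local product structure).
* [Borel1991] A. Borel, *Linear Algebraic Groups*, 2nd ed. (1991), I.4 (4.2, 4.4).
* [Rogawski1990] J. D. Rogawski, *Automorphic Representations of Unitary Groups in Three Variables* (1990), §4.3 p. 43.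
-/

set_option autoImplicit false

noncomputable section

open Filter Topology
open scoped Matrix.Norms.Operator

namespace Literature.NumberTheory.Automorphic

variable {F : Type*} [NontriviallyNormedField F] [CompleteSpace F] {n : Type*} [Fintype n] [DecidableEq n]

/-! ### 1. The strict derivative of `Φ` on the slice `𝔪 × 𝔠` and its invertibility -/

/-- The strict derivative of `(X, Y) ↦ (1 + X)(A + Y)(1 + X)⁻¹` on `C₁ × C₂` (two subspaces of `M_n(F)`) at `(0, 0)`:
a continuous linear `D` with `D (X, Y) = XA − AX + Y` (product rule, strict derivative of `Ring.inverse` at `1`; the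
normed structure is Mathlib's scoped `L^∞`-operator norm, definitionally the product topology). [folklore] -/
private theorem hasStrictFDerivAt_conjOrbitMap_slice (A : Matrix n n F) (C₁ C₂ : Submodule F (Matrix n n F)) :
    ∃ D : (C₁ × C₂) →L[F] Matrix n n F,
      (∀ X : C₁, ∀ Y : C₂, D (X, Y) = (X : Matrix n n F) * A - A * (X : Matrix n n F) + (Y : Matrix n n F)) ∧
      HasStrictFDerivAt (fun p : C₁ × C₂ =>
        (1 + (p.1 : Matrix n n F)) * (A + (p.2 : Matrix n n F)) * Ring.inverse (1 + (p.1 : Matrix n n F))) D 0 := by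
  haveI : CompleteSpace (Matrix n n F) := FiniteDimensional.complete F (Matrix n n F)
  have h1 : HasStrictFDerivAt (fun p : C₁ × C₂ => (1 : Matrix n n F) + (p.1 : Matrix n n F))
      ((C₁.subtypeL).comp (ContinuousLinearMap.fst F C₁ C₂)) 0 :=
    ((C₁.subtypeL).comp (ContinuousLinearMap.fst F C₁ C₂)).hasStrictFDerivAt.const_add 1
  have h2 : HasStrictFDerivAt (fun p : C₁ × C₂ => A + (p.2 : Matrix n n F))
      ((C₂.subtypeL).comp (ContinuousLinearMap.snd F C₁ C₂)) 0 :=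
    ((C₂.subtypeL).comp (ContinuousLinearMap.snd F C₁ C₂)).hasStrictFDerivAt.const_add A
  have hpt : (fun p : C₁ × C₂ => (1 : Matrix n n F) + (p.1 : Matrix n n F)) 0 = ((1 : (Matrix n n F)ˣ) : Matrix n n F) := by
    simp
  have hg : HasStrictFDerivAt (Ring.inverse : Matrix n n F → Matrix n n F)
      (-ContinuousLinearMap.mulLeftRight F (Matrix n n F) ((1 : (Matrix n n F)ˣ)⁻¹ : (Matrix n n F)ˣ)
        ((1 : (Matrix n n F)ˣ)⁻¹ : (Matrix n n F)ˣ))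
      ((fun p : C₁ × C₂ => (1 : Matrix n n F) + (p.1 : Matrix n n F)) 0) := by
    rw [hpt]; exact hasStrictFDerivAt_ringInverse (1 : (Matrix n n F)ˣ)
  have h3 := HasStrictFDerivAt.comp (f := fun p : C₁ × C₂ => (1 : Matrix n n F) + (p.1 : Matrix n n F)) 0 hg h1
  have hΨ := (h1.mul' h2).mul' h3
  refine ⟨_, fun X Y => ?_, hΨ⟩
  refine (?_ : _ = ((1 : Matrix n n F) + ((0 : C₁ × C₂).1 : Matrix n n F)) * (A + ((0 : C₁ × C₂).2 : Matrix n n F)) *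
      (-((((1 : (Matrix n n F)ˣ)⁻¹ : (Matrix n n F)ˣ) : Matrix n n F) * (X : Matrix n n F) *
        (((1 : (Matrix n n F)ˣ)⁻¹ : (Matrix n n F)ˣ) : Matrix n n F))) +
      (((1 : Matrix n n F) + ((0 : C₁ × C₂).1 : Matrix n n F)) * (Y : Matrix n n F) +
          (X : Matrix n n F) * (A + ((0 : C₁ × C₂).2 : Matrix n n F))) *
        Ring.inverse ((1 : Matrix n n F) + ((0 : C₁ × C₂).1 : Matrix n n F))).trans ?_
  · rfl
  · simp only [Prod.fst_zero, Prod.snd_zero, add_zero, ZeroMemClass.coe_zero, inv_one, Units.val_one,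
      Ring.inverse_one, one_mul, mul_one, mul_neg]
    abel

/-! ### 2. The product form of the regular orbit chart -/

/-- **The regular orbit chart, product form.**  For `A ∈ M_n(F)` with separable characteristic polynomial over a
complete nontrivially normed perfect field `F`, with `ad A = L_A − R_A`, slice `𝔪 = range (ad A)` and commutant
`𝔠 = ker (ad A) = C(A)`: there is a homeomorphism `e` between an OPEN neighbourhood of `(0, 0)` in `𝔪 × 𝔠` and an OPEN
neighbourhood of `A` in `M_n(F)` which IS conjugation, `e (X, Y) = (1 + X)(A + Y)(1 + X)⁻¹`.  (The strict derivative
`(X, Y) ↦ −ad A (X) + Y` is an isomorphism `𝔪 × 𝔠 ≃ M_n(F)` since `M_n(F) = 𝔪 ⊕ 𝔠` and `ad A` is injective on `𝔪`,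
★ `isCompl_ker_range_mulLeft_sub_mulRight_of_separable_charpoly`; then Mathlib's inverse function theorem
`HasStrictFDerivAt.toOpenPartialHomeomorph` over `𝕜 = F`.)  Near `A`, every matrix is thus CONTINUOUSLY of the form
`(1 + X(W)) (A + Y(W)) (1 + X(W))⁻¹` with `A + Y(W)` in the torus algebra `C(A)`.
[cite: HarishChandra1970, Part I §3] [cite: Borel1991, I.4 (4.2, 4.4)] [cite: Rogawski1990, §4.3 p. 43] -/
theorem exists_openPartialHomeomorph_conjOrbit [PerfectField F] (A : Matrix n n F) (hA : A.charpoly.Separable) :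
    ∃ e : OpenPartialHomeomorph
        (↥(LinearMap.range (LinearMap.mulLeft F A - LinearMap.mulRight F A : Module.End F (Matrix n n F))) ×
          ↥(LinearMap.ker (LinearMap.mulLeft F A - LinearMap.mulRight F A : Module.End F (Matrix n n F))))
        (Matrix n n F),
      (0 : ↥(LinearMap.range (LinearMap.mulLeft F A - LinearMap.mulRight F A : Module.End F (Matrix n n F))) ×
          ↥(LinearMap.ker (LinearMap.mulLeft F A - LinearMap.mulRight F A : Module.End F (Matrix n n F)))) ∈ e.source ∧
      A ∈ e.target ∧
      ∀ p, e p = (1 + (p.1 : Matrix n n F)) * (A + (p.2 : Matrix n n F)) * Ring.inverse (1 + (p.1 : Matrix n n F)) := by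
  haveI : CompleteSpace (Matrix n n F) := FiniteDimensional.complete F (Matrix n n F)
  set ad : Module.End F (Matrix n n F) := LinearMap.mulLeft F A - LinearMap.mulRight F A with had
  haveI : CompleteSpace ↥(LinearMap.range ad) := FiniteDimensional.complete F _
  haveI : CompleteSpace ↥(LinearMap.ker ad) := FiniteDimensional.complete F _
  haveI : CompleteSpace (↥(LinearMap.range ad) × ↥(LinearMap.ker ad)) := inferInstance
  have hc := Literature.LinearAlgebra.Matrix.isCompl_ker_range_mulLeft_sub_mulRight_of_separable_charpoly A hA
  rw [← had] at hc
  have had_apply : ∀ X : Matrix n n F, ad X = A * X - X * A := fun X => by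
    rw [had, LinearMap.sub_apply, LinearMap.mulLeft_apply, LinearMap.mulRight_apply]
  obtain ⟨D, hD, hΦ⟩ := hasStrictFDerivAt_conjOrbitMap_slice A (LinearMap.range ad) (LinearMap.ker ad)
  -- `D (X, Y) = −ad X + Y` is injective …
  have hinj : LinearMap.ker (D : (↥(LinearMap.range ad) × ↥(LinearMap.ker ad)) →ₗ[F] Matrix n n F) = ⊥ := by
    refine LinearMap.ker_eq_bot'.mpr fun p hp => ?_
    obtain ⟨X, Y⟩ := p
    rw [ContinuousLinearMap.coe_coe, hD] at hp
    -- `↑Y = ad ↑X ∈ range ad ⊓ ker ad = ⊥`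
    have hYeq : (Y : Matrix n n F) = ad (X : Matrix n n F) := by
      rw [had_apply, ← neg_sub ((X : Matrix n n F) * A) (A * (X : Matrix n n F)), eq_neg_iff_add_eq_zero, add_comm]
      exact hp
    have hY0 : (Y : Matrix n n F) = 0 := by
      have hmem : (Y : Matrix n n F) ∈ LinearMap.ker ad ⊓ LinearMap.range ad :=
        Submodule.mem_inf.mpr ⟨Y.2, hYeq ▸ LinearMap.mem_range_self ad _⟩
      rwa [hc.inf_eq_bot, Submodule.mem_bot] at hmem
    have hX0 : (X : Matrix n n F) = 0 := by
      have hXker : (X : Matrix n n F) ∈ LinearMap.ker ad := by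
        rw [LinearMap.mem_ker, ← hYeq, hY0]
      have hmem : (X : Matrix n n F) ∈ LinearMap.ker ad ⊓ LinearMap.range ad :=
        Submodule.mem_inf.mpr ⟨hXker, X.2⟩
      rwa [hc.inf_eq_bot, Submodule.mem_bot] at hmem
    exact Prod.ext (Subtype.ext hX0) (Subtype.ext hY0)
  -- … and surjective (`M_n = [A, M_n] + C(A)`, and `ad` maps `range ad` onto itself)
  have hsurj : LinearMap.range (D : (↥(LinearMap.range ad) × ↥(LinearMap.ker ad)) →ₗ[F] Matrix n n F) = ⊤ := by
    refine LinearMap.range_eq_top.mpr fun Z => ?_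
    obtain ⟨X₀, Y₀, hcomm, hZ⟩ :=
      Literature.LinearAlgebra.Matrix.exists_commute_add_commutator_eq_of_separable_charpoly A hA Z
    have hX₀ : X₀ ∈ LinearMap.ker ad ⊔ LinearMap.range ad := by rw [hc.sup_eq_top]; exact Submodule.mem_top
    obtain ⟨K₀, hK₀, R₀, hR₀, hsum⟩ := Submodule.mem_sup.mp hX₀
    have hY₀ : Y₀ ∈ LinearMap.ker ad := by
      rw [LinearMap.mem_ker, had_apply, ← hcomm, sub_self]
    have hK : A * K₀ - K₀ * A = 0 := by rw [← had_apply]; exact hK₀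
    refine ⟨(⟨-R₀, (LinearMap.range ad).neg_mem hR₀⟩, ⟨Y₀, hY₀⟩), ?_⟩
    rw [ContinuousLinearMap.coe_coe, hD, hZ, ← hsum]
    show (-R₀) * A - A * (-R₀) + Y₀ = (A * (K₀ + R₀) - (K₀ + R₀) * A) + Y₀
    have hK' : A * K₀ = K₀ * A := sub_eq_zero.mp hK
    rw [mul_add, add_mul, hK']
    noncomm_ring
  -- the derivative as a continuous linear EQUIVALENCE, and the inverse function theorem
  have hΦ' := hΦ.congr_fderiv (ContinuousLinearEquiv.coe_ofBijective D hinj hsurj).symm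
  refine ⟨hΦ'.toOpenPartialHomeomorph _, hΦ'.mem_toOpenPartialHomeomorph_source, ?_, fun p => rfl⟩
  have himg := hΦ'.image_mem_toOpenPartialHomeomorph_target
  have h0 : ((1 : Matrix n n F) + ((0 : (↥(LinearMap.range ad) × ↥(LinearMap.ker ad))).1 : Matrix n n F)) * (A + ((0 : (↥(LinearMap.range ad) × ↥(LinearMap.ker ad))).2 : Matrix n n F)) *
      Ring.inverse ((1 : Matrix n n F) + ((0 : (↥(LinearMap.range ad) × ↥(LinearMap.ker ad))).1 : Matrix n n F)) = A := by
    simp only [Prod.fst_zero, Prod.snd_zero, add_zero, ZeroMemClass.coe_zero, Ring.inverse_one, mul_one, one_mul]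
  rw [h0] at himg
  exact himg

end Literature.NumberTheory.Automorphic

end
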